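import Summits.PneNP.PneNP.Theorems.ExpanderLinearGeneratorsLinearGeneratorModPFregeHardPolyCalc
import Literature.Computability.MetaComplexity.XorPseudoexpectation

/-!
# PneNP / ExpanderLinearGenerators — counting-frame barrier, expander half:
the Grigoriev–Schoenebeck pseudoexpectation of the XOR-CNF `sumEncoding 1 E` of a boundary
expander (helper file for stmt-PneNP-11442, `--supports`)

Route `PneNP/ExpanderLinearGenerators`, crux stmt-PneNP-11442
(`Summit.PneNP.PneNP.Theses.ExpanderLinearGenerators.ExpansionForcesDepthFregeSize`), whose family is
the XOR-CNF `sumEncoding 1 E` of an unsolvable `ℓ`-sparse system `E` over `𝔽₂` with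
`(r, 3ℓ/4)`-boundary-expanding row supports. The tree's deterministic Grigoriev–Schoenebeck theorem
`Literature.Computability.MetaComplexity.sosFailsToRefute_of_isBoundaryExpander` is stated for a
CNF whose CLAUSE scopes expand — not directly applicable here, because the `2^{ℓ-1}` clauses of one
row share a scope. This file runs the same construction indexed by ROWS: the pseudo-moments of the
parity system `y_{supp Eᵢ} = (-1)^{bᵢ}` (`pseudoMoment (rowVec E) (rowSign ℝ E) r d`,
`XorDerivation.lean`) composed with the arithmetisation `phi`, and checks every clause identity of
`sumEncoding 1 E` through `clause_sits_on_rows` (file `…LinearGeneratorModPFregeHardPolyCalc`: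
each clause has its row's scope vector and sign) and the pairing lemma
`momentFunctional_phi_unsatPoly_mul`.

* `clauseSignK_real` — the `K`-valued clause sign of the PC rung at `K = ℝ` is `clauseSign`.
* `sosFailsToRefute_sumEncoding_of_isBoundaryExpander` — **degree-`d` SOS fails to refute
  `sumEncoding 1 E` for every `d ≤ c·r/2`** when the row supports of `E` form an
  `(r, c)`-boundary expander (`c > 0`, `r ≥ 2`).

With `…CountingFrameBarrierSos.lean` (no pseudoexpectation of degree `≥ 2t` validates a pigeonhole
frame of degree `t`) this is Theorem III of the item's memo
`memo-11442-s21-counting-frame-barrier.md`: an expanding XOR system carrying a pigeonhole / WPHP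
frame validated in degree `2t` has `c·r < 4t + 2`.

References: D. Grigoriev, TCS 259 (2001), Thm. 1; G. Schoenebeck, FOCS 2008, Thm. 4.1, §5;
P. Kothari, R. Mori, R. O'Donnell, D. Witmer, STOC 2017, Thm. 2.9 [arXiv170104521];
E. Ben-Sasson, A. Wigderson, J. ACM 48 (2001), §5–6 [BenSassonWigderson2001].
-/

noncomputable section

namespace Summit.PneNP.PneNP.Theorems

set_option linter.dupNamespace false -- `Summit.PneNP.PneNP.…`: summit = sub-problem (D-0017)

open Finset MvPolynomial Literature.Computability.Complexity Literature.Computability.MetaComplexity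
open Summit.PneNP.PneNP.Theorems.PolyCalc

namespace CountingFrameBarrier

variable {m n : ℕ}

/-- At `K = ℝ` the clause sign of the PC rung (`clauseSignK`) is the clause sign of
`XorPseudoexpectation.lean` (same definition). [folklore] -/
theorem clauseSignK_real (C : Clause ℕ) : clauseSignK ℝ C = clauseSign C := rfl

/-- **Grigoriev–Schoenebeck for the XOR-CNF of a boundary expander.** If the row supports of
`E : Fin m → LinEqMod 2 n` form an `(r, c)`-boundary expander with `c > 0`, `r ≥ 2`, then for every
`d ≤ c·r/2` degree-`d` SOS fails to refute `sumEncoding 1 E`: the functional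
`p ↦ L(phi p)`, `L(y_T) =` the pseudo-moment of `T` for the parity system of the rows, is a
degree-`d` pseudoexpectation satisfying Booleanity and every clause identity.
[Grigoriev 2001, Thm. 1; Schoenebeck 2008, Thm. 4.1 with §5; Kothari–Mori–O'Donnell–Witmer 2017,
Thm. 2.9] [folklore] -/
theorem sosFailsToRefute_sumEncoding_of_isBoundaryExpander (E : Fin m → LinEqMod 2 n)
    {r c : ℝ} {d : ℕ}
    (hexp : IsBoundaryExpander (fun i => (E i).supp.map Fin.valEmbedding) r c)
    (hc : 0 < c) (hr : 2 ≤ r) (hd : (d : ℝ) ≤ c * r / 2) :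
    SOSFailsToRefute d (sumEncoding 1 E) := by
  classical
  have hvec : VecExpands (rowVec E) r c := vecExpands_of_isBoundaryExpander hexp
  have hb : ∀ i, rowSign ℝ E i * rowSign ℝ E i = 1 := rowSign_mul_self E
  have hr0 : (0 : ℝ) ≤ r := by linarith
  refine ⟨momentFunctional (pseudoMoment (rowVec E) (rowSign ℝ E) r d) ∘ₗ phi.toLinearMap,
    ⟨?_, ?_⟩, ?_, ?_⟩
  · -- normalisation
    show momentFunctional _ (phi 1) = 1
    rw [map_one, AddMonoidAlgebra.one_def, momentFunctional_single, one_mul,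
      pseudoMoment_zero hvec hc hd hr0]
  · -- positivity
    intro p hp
    show 0 ≤ momentFunctional _ (phi (p * p))
    rw [map_mul, momentFunctional_mul]
    refine pseudoMoment_quadratic_nonneg hvec hc hd hr0 hb _ (fun T => (phi p).coeff T) ?_
    intro T hT
    have := card_support_le_totalDegree p hT
    omega
  · -- Booleanity
    intro v q _
    show momentFunctional _ (phi (boolAxiom v * q)) = 0
    rw [map_mul, phi_boolAxiom, zero_mul, map_zero]
  · -- clause identities, row by row
    intro C hC q hq
    obtain ⟨i, hlen, hgi, hbi⟩ := clause_sits_on_rows (K := ℝ) E hC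
    have hlenpos : 0 < C.length := by
      have h1 := hvec {i} (by rw [Finset.card_singleton, Nat.cast_one]; linarith)
      rw [famVec_singleton, rowVec, support_indVec, Finset.card_map, Finset.card_singleton,
        Nat.cast_one, mul_one] at h1
      have h2 : (0 : ℝ) < (E i).supp.card := hc.trans_le h1
      rw [hlen]
      exact_mod_cast h2
    show momentFunctional _ (phi (unsatPoly C * q)) = 0
    rw [map_mul]
    refine momentFunctional_phi_unsatPoly_mul hvec hc hd hr hb C hlenpos i hgi
      (by rw [hbi, clauseSignK_real]) (phi q) ?_
    intro U hU
    have := card_support_le_totalDegree q hU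
    rw [totalDegree_unsatPoly] at hq
    omega

end CountingFrameBarrier

end Summit.PneNP.PneNP.Theorems
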